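import Summits.Langlands.Langlands.Theorems.SqrtFiveQuarticCoversE7DescentW5Local

/-!
# Route `Langlands/SqrtFiveQuarticCovers`, sheet 4.5 row 8 — 2-descent for `W⁵ = 1225.c1`: the gcd bound

For coprime `(M, e)` with `N² = M⁴ + 1470M²e² − 8575e⁴` (a class-1 point `x = M²/e²` of
`W⁵ : y² = x(x² + 1470x − 8575)`), every common divisor `g` of `A = M⁴ + 8575e⁴` and `2Me|N|`
divides `137200 = 2⁴5²7³` (`W5_gcd_bound`): two Bezout identities (`ring`) give `g ∣ 2⁸5⁴7⁶`; the
exponents are trimmed by `W5_two_adic` (for odd `M, e` the quartic `Q = (M² + 735e²)² − 548800e⁴` is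
never `0 mod 256`: `ZMod 256` certificates `548800·f⁴ = 192` for odd `f` and `s² ≠ 192`),
`W5_five_cube_not_dvd`, `W5_seven_pow_four_not_dvd`.  This is «THE ONE INEQUALITY» of the Fermat
descent in `…E7DescentW5.lean` (eng-8 g3, E7-MW-FERMAT).

HONEST STATUS: elementary kernel arithmetic; no named input; not a modularity statement.
-/

set_option linter.dupNamespace false -- project-wide option; `Summit.Langlands.Langlands` is the mandated namespace

namespace Summit.Langlands.Langlands.Theorems.SqrtFiveQuarticCovers

/-! ### §1 The gcd bound `g ∣ 137200` -/

/-- Bezout identity eliminating `M`: `U·A + V·C = 2⁸5⁴7⁶·e⁹`, `A = M⁴ + 8575e⁴`,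
`C = 2Me(M⁴ + 1470M²e² − 8575e⁴)`. [folklore] -/
theorem W5_bezout_e (M e : ℤ) :
    (2195200 * e ^ 5 - 1470 * M ^ 2 * e ^ 3 - 2 * M ^ 4 * e) * (M ^ 4 + 8575 * e ^ 4)
      + (M ^ 3 - 735 * M * e ^ 2) * (2 * M * e * (M ^ 4 + 1470 * M ^ 2 * e ^ 2 - 8575 * e ^ 4))
      = 18823840000 * e ^ 9 := by
  ring

/-- Bezout identity eliminating `e`: `U'·A + V'·C = 2⁸·M⁹`. [folklore] -/
theorem W5_bezout_M (M e : ℤ) :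
    (256 * M ^ 5 + 1470 * M ^ 3 * e ^ 2 - 17150 * M * e ^ 4) * (M ^ 4 + 8575 * e ^ 4)
      + (-8575 * e ^ 3 - 735 * M ^ 2 * e) * (2 * M * e * (M ^ 4 + 1470 * M ^ 2 * e ^ 2 - 8575 * e ^ 4))
      = 256 * M ^ 9 := by
  ring

set_option maxRecDepth 8192 in
/-- `548800·f⁴ ≡ 192 (mod 256)` for odd `f` (`548800 = 2⁶·8575`). [folklore] -/
theorem zmod256_c548800_mul_odd_fourth : ∀ f : ZMod 256, (128 : ZMod 256) * f ≠ 0 →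
    (548800 : ZMod 256) * f ^ 4 = 192 := by
  decide

set_option maxRecDepth 8192 in
/-- `192` is not a square mod `256`. [folklore] -/
theorem zmod256_sq_ne_192 : ∀ s : ZMod 256, s ^ 2 ≠ 192 := by
  decide

/-- **The 2-adic trim.**  For coprime `(M, e)` with `N² = Q = M⁴ + 1470M²e² − 8575e⁴`: not both
`32 ∣ M⁴ + 8575e⁴` and `32 ∣ 2Me|N|`.  (The first forces `M, e` odd; then `16 ∣ N`, `256 ∣ Q`; but
`Q + 548800e⁴ = (M² + 735e²)²` and `548800e⁴ ≡ 192 (mod 256)` for odd `e`, while `192` is not a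
square mod `256`.) [folklore] -/
theorem W5_two_adic {M e : ℕ} {N : ℤ} (hcop : Nat.Coprime M e)
    (hN : N ^ 2 = (M : ℤ) ^ 4 + 1470 * M ^ 2 * e ^ 2 - 8575 * e ^ 4) :
    ¬ (32 ∣ M ^ 4 + 8575 * e ^ 4 ∧ 32 ∣ 2 * M * e * N.natAbs) := by
  rintro ⟨hA, hB⟩
  -- `M`, `e` have the same parity, hence are both odd
  have hpar : ∀ m f : ZMod 2, m ^ 4 + 8575 * f ^ 4 = 0 → m = f := by decide
  have hc2 : ((M : ℕ) : ZMod 2) ^ 4 + 8575 * ((e : ℕ) : ZMod 2) ^ 4 = 0 := by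
    have h := (ZMod.natCast_eq_zero_iff (M ^ 4 + 8575 * e ^ 4) 2).mpr ((show (2 : ℕ) ∣ 32 by norm_num).trans hA)
    push_cast at h
    exact h
  have hMe := hpar _ _ hc2
  have hMo : ¬ 2 ∣ M := by
    intro h2M
    have hM0 : ((M : ℕ) : ZMod 2) = 0 := (ZMod.natCast_eq_zero_iff M 2).mpr h2M
    have h2e : 2 ∣ e := (ZMod.natCast_eq_zero_iff e 2).mp (by rw [← hMe, hM0])
    have : 2 ∣ Nat.gcd M e := Nat.dvd_gcd h2M h2e
    rw [Nat.Coprime.gcd_eq_one hcop] at this; omega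
  have heo : ¬ 2 ∣ e := by
    intro h2e
    apply hMo
    have he0 : ((e : ℕ) : ZMod 2) = 0 := (ZMod.natCast_eq_zero_iff e 2).mpr h2e
    exact (ZMod.natCast_eq_zero_iff M 2).mp (by rw [hMe, he0])
  -- `16 ∣ |N|`
  have h16N : 16 ∣ N.natAbs := by
    have h1 : 16 ∣ M * e * N.natAbs := by
      have : 2 * 16 ∣ 2 * (M * e * N.natAbs) := by
        rw [show 2 * (M * e * N.natAbs) = 2 * M * e * N.natAbs by ring]; exact hB
      exact Nat.dvd_of_mul_dvd_mul_left (by norm_num) this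
    have hc : Nat.Coprime 16 (M * e) := by
      rw [show (16 : ℕ) = 2 ^ 4 by norm_num]
      exact Nat.Coprime.pow_left 4
        (Nat.Coprime.mul_right ((Nat.prime_two.coprime_iff_not_dvd).mpr hMo)
          ((Nat.prime_two.coprime_iff_not_dvd).mpr heo))
    exact hc.dvd_of_dvd_mul_left h1
  have h16N' : (16 : ℤ) ∣ N := Int.dvd_natAbs.mp (by exact_mod_cast h16N)
  obtain ⟨N', rfl⟩ := h16N'
  -- in `ZMod 256`: `S² = (16N')² + 548800e⁴ = 0 + 192`
  have hS : ((M : ℤ) ^ 2 + 735 * (e : ℤ) ^ 2) ^ 2 = (16 * N') ^ 2 + 548800 * (e : ℤ) ^ 4 := by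
    linear_combination (-1 : ℤ) * hN
  have hc := congrArg (Int.cast : ℤ → ZMod 256) hS
  push_cast at hc
  have h256 : ((16 : ZMod 256) * (N' : ZMod 256)) ^ 2 = 0 := by
    rw [mul_pow, show ((16 : ZMod 256)) ^ 2 = 0 by decide, zero_mul]
  have hf : (128 : ZMod 256) * ((e : ℤ) : ZMod 256) ≠ 0 := by
    intro h0
    apply heo
    have := (zmod_mul_intCast_eq_zero_iff (m := 256) (k := 128) (d := 2) rfl (by norm_num) (e : ℤ)).mp
      (by exact_mod_cast h0)
    exact_mod_cast this
  have hf' : (128 : ZMod 256) * ((e : ℕ) : ZMod 256) ≠ 0 := by exact_mod_cast hf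
  rw [h256, zero_add, zmod256_c548800_mul_odd_fourth _ hf'] at hc
  exact zmod256_sq_ne_192 _ hc

/-- `5³ ∤ M⁴ + 8575e⁴` for coprime `(M, e)` (`5 ∣ M` would force `5 ∣ e`). [folklore] -/
theorem W5_five_cube_not_dvd {M e : ℕ} (hcop : Nat.Coprime M e) : ¬ 5 ^ 3 ∣ M ^ 4 + 8575 * e ^ 4 := by
  intro h
  have h5A : 5 ∣ M ^ 4 + 8575 * e ^ 4 := (dvd_pow_self 5 (by norm_num)).trans h
  have h5M4 : 5 ∣ M ^ 4 :=
    (Nat.dvd_add_left (dvd_mul_of_dvd_left (by norm_num : 5 ∣ 8575) _)).mp h5A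
  have h5M : 5 ∣ M := Nat.prime_five.dvd_of_dvd_pow h5M4
  obtain ⟨M', rfl⟩ := h5M
  have h' : 5 ^ 3 ∣ 8575 * e ^ 4 := by
    have : 5 ^ 3 ∣ (5 * M') ^ 4 := ⟨5 * M' ^ 4, by ring⟩
    exact (Nat.dvd_add_right this).mp h
  have h5e4 : 5 ∣ 343 * e ^ 4 := by
    have : 25 * 5 ∣ 25 * (343 * e ^ 4) := by
      rw [show 25 * (343 * e ^ 4) = 8575 * e ^ 4 by ring]; norm_num at h' ⊢; exact h'
    exact Nat.dvd_of_mul_dvd_mul_left (by norm_num) this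
  have h5e : 5 ∣ e :=
    Nat.prime_five.dvd_of_dvd_pow ((Nat.Coprime.dvd_mul_left (by norm_num : Nat.Coprime 5 343)).mp h5e4)
  have : 5 ∣ Nat.gcd (5 * M') e := Nat.dvd_gcd (dvd_mul_right 5 M') h5e
  rw [Nat.Coprime.gcd_eq_one hcop] at this
  omega

/-- `7⁴ ∤ M⁴ + 8575e⁴` for coprime `(M, e)` (`7 ∣ M` would force `7 ∣ e`). [folklore] -/
theorem W5_seven_pow_four_not_dvd {M e : ℕ} (hcop : Nat.Coprime M e) : ¬ 7 ^ 4 ∣ M ^ 4 + 8575 * e ^ 4 := by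
  intro h
  have h7A : 7 ∣ M ^ 4 + 8575 * e ^ 4 := (dvd_pow_self 7 (by norm_num)).trans h
  have h7M4 : 7 ∣ M ^ 4 :=
    (Nat.dvd_add_left (dvd_mul_of_dvd_left (by norm_num : 7 ∣ 8575) _)).mp h7A
  have h7M : 7 ∣ M := Nat.prime_seven.dvd_of_dvd_pow h7M4
  obtain ⟨M', rfl⟩ := h7M
  have h' : 7 ^ 4 ∣ 8575 * e ^ 4 := by
    have : 7 ^ 4 ∣ (7 * M') ^ 4 := ⟨M' ^ 4, by ring⟩
    exact (Nat.dvd_add_right this).mp h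
  have h7e4 : 7 ∣ 25 * e ^ 4 := by
    have : 343 * 7 ∣ 343 * (25 * e ^ 4) := by
      rw [show 343 * (25 * e ^ 4) = 8575 * e ^ 4 by ring]; norm_num at h' ⊢; exact h'
    exact Nat.dvd_of_mul_dvd_mul_left (by norm_num) this
  have h7e : 7 ∣ e :=
    Nat.prime_seven.dvd_of_dvd_pow ((Nat.Coprime.dvd_mul_left (by norm_num : Nat.Coprime 7 25)).mp h7e4)
  have : 7 ∣ Nat.gcd (7 * M') e := Nat.dvd_gcd (dvd_mul_right 7 M') h7e
  rw [Nat.Coprime.gcd_eq_one hcop] at this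
  omega

/-- **The gcd bound.**  For coprime `(M, e)` with `N² = M⁴ + 1470M²e² − 8575e⁴`, every common
divisor `g` of `A = M⁴ + 8575e⁴` and `2Me|N|` divides `137200 = 2⁴5²7³`. [folklore] -/
theorem W5_gcd_bound {M e : ℕ} {N : ℤ} (hcop : Nat.Coprime M e)
    (hN : N ^ 2 = (M : ℤ) ^ 4 + 1470 * M ^ 2 * e ^ 2 - 8575 * e ^ 4)
    {g : ℕ} (hgA : g ∣ M ^ 4 + 8575 * e ^ 4) (hgB : g ∣ 2 * M * e * N.natAbs) : g ∣ 137200 := by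
  have hgA' : (g : ℤ) ∣ (M : ℤ) ^ 4 + 8575 * e ^ 4 := by exact_mod_cast hgA
  have hgC : (g : ℤ) ∣ 2 * M * e * ((M : ℤ) ^ 4 + 1470 * M ^ 2 * e ^ 2 - 8575 * e ^ 4) := by
    have h1 : (g : ℤ) ∣ 2 * M * e * (N.natAbs : ℤ) := by exact_mod_cast hgB
    rw [← hN]
    exact h1.trans (mul_dvd_mul_left _ (Int.natAbs_dvd.mpr (dvd_pow_self N two_ne_zero)))
  have h1 : (g : ℤ) ∣ 18823840000 * (e : ℤ) ^ 9 := by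
    rw [← W5_bezout_e]
    exact dvd_add (dvd_mul_of_dvd_right hgA' _) (dvd_mul_of_dvd_right hgC _)
  have h2 : (g : ℤ) ∣ 18823840000 * (M : ℤ) ^ 9 := by
    have : (g : ℤ) ∣ 256 * (M : ℤ) ^ 9 := by
      rw [← W5_bezout_M]
      exact dvd_add (dvd_mul_of_dvd_right hgA' _) (dvd_mul_of_dvd_right hgC _)
    rw [show (18823840000 : ℤ) * (M : ℤ) ^ 9 = 73530625 * (256 * (M : ℤ) ^ 9) by ring]
    exact dvd_mul_of_dvd_right this _
  have h1N : g ∣ 18823840000 * e ^ 9 := by exact_mod_cast h1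
  have h2N : g ∣ 18823840000 * M ^ 9 := by exact_mod_cast h2
  have hR : g ∣ 2 ^ 8 * 5 ^ 4 * 7 ^ 6 := by
    have := Nat.dvd_gcd h1N h2N
    rwa [Nat.gcd_mul_left, Nat.Coprime.gcd_eq_one (Nat.Coprime.pow 9 9 hcop.symm), mul_one] at this
  have hsplit : g = Nat.gcd g (2 ^ 8) * Nat.gcd g (5 ^ 4) * Nat.gcd g (7 ^ 6) := by
    rw [← Nat.Coprime.gcd_mul g (by norm_num : Nat.Coprime (2 ^ 8) (5 ^ 4)),
      ← Nat.Coprime.gcd_mul g (by norm_num : Nat.Coprime (2 ^ 8 * 5 ^ 4) (7 ^ 6)), Nat.gcd_eq_left hR]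
  obtain ⟨i, hi, hgi⟩ := (Nat.dvd_prime_pow Nat.prime_two).mp (Nat.gcd_dvd_right g (2 ^ 8))
  obtain ⟨j, hj, hgj⟩ := (Nat.dvd_prime_pow Nat.prime_five).mp (Nat.gcd_dvd_right g (5 ^ 4))
  obtain ⟨k, hk, hgk⟩ := (Nat.dvd_prime_pow Nat.prime_seven).mp (Nat.gcd_dvd_right g (7 ^ 6))
  rw [hgi, hgj, hgk] at hsplit
  have hi4 : i ≤ 4 := by
    by_contra hi4
    apply W5_two_adic hcop hN
    have h32 : 32 ∣ g := by
      rw [hsplit]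
      have h5i : 5 ≤ i := by omega
      have : 2 ^ 5 ∣ 2 ^ i := Nat.pow_dvd_pow 2 h5i
      exact dvd_mul_of_dvd_left (dvd_mul_of_dvd_left (by norm_num at this; exact this) _) _
    exact ⟨h32.trans hgA, h32.trans hgB⟩
  have hj2 : j ≤ 2 := by
    by_contra hj2
    apply W5_five_cube_not_dvd hcop
    refine dvd_trans ?_ hgA
    rw [hsplit]
    have h3j : 3 ≤ j := by omega
    exact dvd_mul_of_dvd_left (dvd_mul_of_dvd_right (Nat.pow_dvd_pow 5 h3j) _) _
  have hk3 : k ≤ 3 := by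
    by_contra hk3
    apply W5_seven_pow_four_not_dvd hcop
    refine dvd_trans ?_ hgA
    rw [hsplit]
    have h4k : 4 ≤ k := by omega
    exact dvd_mul_of_dvd_right (Nat.pow_dvd_pow 7 h4k) _
  rw [hsplit, show (137200 : ℕ) = 2 ^ 4 * 5 ^ 2 * 7 ^ 3 by norm_num]
  exact Nat.mul_dvd_mul (Nat.mul_dvd_mul (Nat.pow_dvd_pow 2 hi4) (Nat.pow_dvd_pow 5 hj2))
    (Nat.pow_dvd_pow 7 hk3)

end Summit.Langlands.Langlands.Theorems.SqrtFiveQuarticCovers
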